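import Mathlib
import Summits.ResolutionOfSingularities.ResolutionOfSingularities.Theorems.HomologicalConductorPersistenceConductorFloorGeneral
import Literature.RingTheory.CohomologyAnnihilator.StableAnnihilation
import Literature.RingTheory.CohomologyAnnihilator.StrongGenerator
import Literature.RingTheory.CohomologyAnnihilator.SyzygyBasic
import Literature.RingTheory.CohomologyAnnihilator.TowerBasic
import HarnessLib

/-!
# Rung S-2 `PersistenceSurface` (stmt-ResolutionOfSingularities-19970) — the CONDUCTOR FLOOR WITHOUT the
# principal hypothesis, II: `𝔠` a second `C`-syzygy (e.g. reflexive) ⇒ `𝔠²·(ca³(C))² ⊆ ca³(B)`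

Route `ResolutionOfSingularities/HomologicalConductor`, chain W4.4b (cell `res-hironaka`), rung S-2
`PersistenceSurface` (stmt-ResolutionOfSingularities-19970), registered stub
`stub_levelFourPersistenceNonnormalOrNonrational'` (L-other′; class Σ8 = NON-NORMAL stage `0`), cell R5 / S-c.
Seat res-L1-w44b-stub-3 (gen 7); sequel of `…PersistenceConductorFloorGeneral` (same seat, p555200:
`W(Bⁿ) ≅ 𝔠ⁿ`, `W(P)` a retract of `𝔠ⁿ`, the floor for a projective conductor), answering res-L1-w44b-lead-1's
«kernel next» items (i)/(ii)/(iii) of `S2-LEAD-g3.md` §4 beyond the invertible case.  `[OURS · L1 w44b]`; folklore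
module theory; NOT a statement of the manuscript under review (Hironaka 2017) and no statement of that manuscript
is used; AI-written, weaker than expert review.

## Results (notation of `…PersistenceConductorFloorGeneral`: `B → C` injective birational, `C` a noetherian
## domain, `𝔠 ⊆ C` the conductor with `h𝔠 : γ ∈ 𝔠 ↔ γ·C ⊆ B`, `W = Hom_B(C|_B, –)`)

* `smul_ext_coext_eq_zero_of_isSyzygy_two_conductor` — if `𝔠 ≅ Ω²_C M₀` then every `y ∈ ca³(C)` kills
  `Extʲ_C(W(P), N)` for `j ≥ 1`, `N` finitely generated, `P` finitely generated projective over `B`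
  (`y · Extʲ(𝔠, N) = y · Extʲ⁺²(M₀, N) = 0`; `W(P)` is a retract of `𝔠ⁿ`).
* **`mul_mem_cohomologyAnnihilatorOfDegree_three_of_conductor_of_isSyzygy_two`** — THE FLOOR FOR A CONDUCTOR
  THAT IS A SECOND `C`-SYZYGY: `c·(c'·y₁y₂) ∈ ca³(B)` for conductor elements `c, c'` and `y₁, y₂ ∈ ca³(C)`; so
  `𝔠²·(ca³(C))² ⊆ ca³(B)`.  For a second `B`-syzygy `K = ker(P → P')`:
  `W(K) = ker(W(P) → W(P') ↪ 𝔠ⁿ' ↪ Cⁿ')` (left exactness, p552596); with `N ⊆ Cⁿ'` the image,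
  `0 → W(K) → W(P) → N → 0` is short exact, `y₁ · Ext¹(W(P), –) = 0` and `y₂ · Ext²(N, –) = y₂ · Ext³(Cⁿ'/N, –) = 0`
  on finitely generated arguments, so `y₁y₂ · Ext¹(W(K), –) = 0` (tree `mul_smul_ext_eq_zero_of_shortExact`);
  the dual splitting criterion factors `y₁y₂ • 𝟙_{W(K)}` through a finite free module and p551581's transfer +
  CA1 conclude.
  A reflexive `𝔠` is a second syzygy (p553024's `exists_isSyzygy_two_of_isReflexive`; corollary filed in the sequel
  `…ConductorFloorReflexive` once the farm serves p553024); every `S₂` surface stage `B` inside a normal `C` has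
  `𝔠 = Hom_B(C, B)` reflexive (`S₂`, torsion-free, rank one).
* `Subalgebra.mul_conductor_mem_cohomologyAnnihilatorOfDegree_three_of_projective` / `…_of_isSyzygy_two` —
  the route's vocabulary (item (ii)): subalgebras `B ≤ C` of a field `K` with `Frac B = K`.
* Level bookkeeping (item (iii): `ca(R) = ca³(R) ⊆ 𝔠` level-free at `2`-periodic / power-basis surface stages,
  tree `PeriodicSaturation` + p550697) is filed in the sequel `…ConductorFloorReflexive` (it imports p550697's
  file, whose farm olean lags at the time of writing).

With p550697's ceiling: `𝔠²·(ca³ T̄₀)² ⊆ ca³(T₀) ⊆ 𝔠` at a non-normal surface stage `T₀ ⊂ T̄₀` with reflexive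
conductor — radically `V(ca³ T₀) = V(𝔠) ∪ (V(ca³ T̄₀) ∩ Spec T₀)`: R5's «centre of the pinched germ = conductor
locus ∪ centre of the normalisation» holds SET-THEORETICALLY for every `S₂` surface stage (the ideal-theoretic
transitivity `ca(T₀)·T̄₀ = 𝔠·ca(T̄₀)` asked by R5 is NOT claimed).

References (mechanism only): S. B. Iyengar, R. Takahashi, IMRN 2016, Remarks 2.3, 2.13 [`IyengarTakahashi2014`].
-/

-- single-problem summit: the doubled namespace component `ResolutionOfSingularities` is forced
set_option linter.dupNamespace false

noncomputable section

open CategoryTheory CategoryTheory.Abelian Literature.RingTheory.CohomologyAnnihilator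
open Summit.ResolutionOfSingularities.ResolutionOfSingularities.Theorems.NoZeno.SandwichCluster
open Summit.ResolutionOfSingularities.ResolutionOfSingularities.Theorems.HomologicalConductor.PersistenceConductorCoextension
  (stablyAnnihilates_of_coextension_factor)
open Summit.ResolutionOfSingularities.ResolutionOfSingularities.Theorems.HomologicalConductor.PersistenceConductorFloorGeneral
  (exists_coext_retract_pi_conductor finite_coext
    mul_mem_cohomologyAnnihilatorOfDegree_three_of_conductor_of_projective)

universe u

namespace Summit.ResolutionOfSingularities.ResolutionOfSingularities.Theorems.HomologicalConductor.PersistenceConductorFloorSyzygy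

variable {B C : Type u} [CommRing B] [CommRing C] [Algebra B C]

/-! ## The floor for a conductor that is a SECOND `C`-SYZYGY (e.g. reflexive) -/

/-- **`y ∈ ca³(C)` kills `Ext^{≥1}_C(W(P), –)` when `𝔠` is a second `C`-syzygy.**  `𝔠 = Ω²_C M₀` gives
`y · Extʲ(𝔠, N) = y · Extʲ⁺²(M₀, N) = 0` for `j ≥ 1` (`M₀`, `N` finitely generated), and `W(P)` is a retract of
`𝔠ⁿ`. [cite: IyengarTakahashi2014, Remark 2.3] -/
theorem smul_ext_coext_eq_zero_of_isSyzygy_two_conductor [IsDomain C] [IsNoetherianRing C]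
    (hinj : Function.Injective (algebraMap B C))
    (hbir : ∀ γ : C, ∃ b : B, b ≠ 0 ∧ ∃ b' : B, algebraMap B C b' = algebraMap B C b * γ)
    (𝔠 : Ideal C) (h𝔠 : ∀ γ : C, γ ∈ 𝔠 ↔ ∀ δ : C, ∃ b : B, algebraMap B C b = γ * δ)
    {M₀ : ModuleCat.{u} C} (h𝔠syz : IsSyzygy 2 M₀ (ModuleCat.of C ↥𝔠))
    {y : C} (hy : y ∈ cohomologyAnnihilatorOfDegree C 3)
    (P : Type u) [AddCommGroup P] [Module B P] [Module.Finite B P] [Module.Projective B P]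
    (N : ModuleCat.{u} C) [Module.Finite C N] {j : ℕ} (hj : 1 ≤ j)
    (e : Ext.{u} (ModuleCat.of C (((ModuleCat.restrictScalars (algebraMap B C)).obj (ModuleCat.of C C))
      →ₗ[B] P)) N j) :
    y • e = 0 := by
  -- `M₀` is finitely generated (a quotient of the projective in the first syzygy step)
  obtain ⟨K', P', h1, -, -, -, -, -, -⟩ := id h𝔠syz
  haveI : Module.Finite C M₀ := finite_of_isSyzygy_one h1
  have h𝔠kill : ∀ e' : Ext.{u} (ModuleCat.of C ↥𝔠) N j, y • e' = 0 := fun e' =>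
    ext_smul_eq_zero_of_isSyzygy 2 h𝔠syz N j hj y
      (fun e'' => smul_eq_zero_of_mem_cohomologyAnnihilatorOfDegree hy (by omega) e'') e'
  obtain ⟨n, i, p, h⟩ := exists_coext_retract_pi_conductor hinj hbir 𝔠 h𝔠 P
  have hpi : ∀ e' : Ext.{u} (ModuleCat.of C (Fin n → ↥𝔠)) N j, y • e' = 0 := fun e' =>
    ext_smul_eq_zero_of_pi (G := ModuleCat.of C ↥𝔠) y h𝔠kill n e'
  refine ext_smul_eq_zero_of_retract (X := ModuleCat.of C (((ModuleCat.restrictScalars (algebraMap B C)).obj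
      (ModuleCat.of C C)) →ₗ[B] P)) (Z := ModuleCat.of C (Fin n → ↥𝔠))
    (ModuleCat.ofHom i) (ModuleCat.ofHom p) ?_ y hpi e
  ext θ w
  simpa using LinearMap.congr_fun (h θ) w

/-- **THE CONDUCTOR FLOOR FOR A CONDUCTOR THAT IS A SECOND `C`-SYZYGY.**  `B → C` injective and birational,
`B`, `C` noetherian, `C` a domain, `𝔠 ⊆ C` the conductor (`γ ∈ 𝔠 ↔ γ·C ⊆ B`) with `𝔠 ≅ Ω²_C M₀` for some `M₀`
(e.g. `𝔠` reflexive over `C` — automatic for an `S₂` surface stage `B` inside its normalisation); then for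
conductor elements `c, c'` and `y₁, y₂ ∈ ca³(C)`: `c·(c'·y₁y₂) ∈ ca³(B)`, i.e. `𝔠²·(ca³(C))² ⊆ ca³(B)`.
Proof: for a second `B`-syzygy `K = ker(P → P')`, `W(K) = ker(W(P) → W(P') ↪ 𝔠ⁿ' ↪ Cⁿ')` (left exactness;
`W(P')` is a retract of `𝔠ⁿ'`); with `N ⊆ Cⁿ'` the image, `0 → W(K) → W(P) → N → 0` is exact, `y₁` kills
`Ext¹(W(P), –)` (`W(P)` a retract of `𝔠ⁿ`, `𝔠` a second syzygy) and `y₂` kills `Ext²(N, –) ≅ Ext³(Cⁿ'/N, –)`, so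
`y₁y₂` kills `Ext¹(W(K), –)` on finitely generated arguments (tree `mul_smul_ext_eq_zero_of_shortExact`); the
dual splitting criterion factors `y₁y₂ • 𝟙_{W(K)}` through a finite free module, and p551581's transfer gives
`StablyAnnihilates B (c·(c'y₁y₂)) K`; CA1. [cite: IyengarTakahashi2014, Remark 2.13] -/
theorem mul_mem_cohomologyAnnihilatorOfDegree_three_of_conductor_of_isSyzygy_two [IsNoetherianRing B]
    [IsDomain C] [IsNoetherianRing C] (hinj : Function.Injective (algebraMap B C))
    (hbir : ∀ γ : C, ∃ b : B, b ≠ 0 ∧ ∃ b' : B, algebraMap B C b' = algebraMap B C b * γ)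
    (𝔠 : Ideal C) (h𝔠 : ∀ γ : C, γ ∈ 𝔠 ↔ ∀ δ : C, ∃ b : B, algebraMap B C b = γ * δ)
    {M₀ : ModuleCat.{u} C} (h𝔠syz : IsSyzygy 2 M₀ (ModuleCat.of C ↥𝔠))
    {c c' : B} (hc : ∀ γ : C, ∃ b : B, algebraMap B C b = algebraMap B C c * γ)
    (hc' : ∀ γ : C, ∃ b : B, algebraMap B C b = algebraMap B C c' * γ)
    {y₁ y₂ : C} (hy₁ : y₁ ∈ cohomologyAnnihilatorOfDegree C 3) (hy₂ : y₂ ∈ cohomologyAnnihilatorOfDegree C 3)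
    {b : B} (hb : algebraMap B C b = algebraMap B C c' * (y₁ * y₂)) :
    c * b ∈ cohomologyAnnihilatorOfDegree B 3 := by
  refine (mem_cohomologyAnnihilatorOfDegree_succ_iff_forall_isSyzygy (n := 2) (c * b)).mpr
    fun M K hM hK => ?_
  -- unpack the second `B`-syzygy `K ↪ P ↠ K' ↪ P' ↠ K'' ≅ M`
  obtain ⟨K', P, h1, hPfin, hPproj, f, g, w, hS⟩ := hK
  obtain ⟨K'', P', -, hP'fin, hP'proj, f', g', w', hS'⟩ := h1
  haveI := hPfin
  haveI := hP'fin
  haveI : Module.Projective B P := (IsProjective.iff_projective (R := B) P).mpr hPproj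
  haveI : Module.Projective B P' := (IsProjective.iff_projective (R := B) P').mpr hP'proj
  have hf : Function.Injective f.hom := (ModuleCat.mono_iff_injective f).mp hS.mono_f
  have hf' : Function.Injective f'.hom := (ModuleCat.mono_iff_injective f').mp hS'.mono_f
  let φ : P →ₗ[B] P' := f'.hom ∘ₗ g.hom
  have hfφ : LinearMap.range f.hom = LinearMap.ker φ := by
    rw [LinearMap.ker_comp_of_ker_eq_bot _ (LinearMap.ker_eq_bot.mpr hf')]
    exact hS.exact.moduleCat_range_eq_ker
  haveI hWP : Module.Finite C (((ModuleCat.restrictScalars (algebraMap B C)).obj (ModuleCat.of C C)) →ₗ[B] P) :=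
    finite_coext hinj hbir 𝔠 h𝔠 P
  -- `W(φ) : W(P) → W(P')`, `W(f) : W(K) → W(P)`, and `W(P') ↪ 𝔠ⁿ' ↪ Cⁿ'`
  let Wφ : (((ModuleCat.restrictScalars (algebraMap B C)).obj (ModuleCat.of C C)) →ₗ[B] P) →ₗ[C]
      (((ModuleCat.restrictScalars (algebraMap B C)).obj (ModuleCat.of C C)) →ₗ[B] P') :=
    { toFun := fun θ => φ ∘ₗ θ
      map_add' := fun θ θ' => LinearMap.comp_add _ _ _
      map_smul' := fun s θ => by apply LinearMap.ext; intro w; rfl }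
  let Wf : (((ModuleCat.restrictScalars (algebraMap B C)).obj (ModuleCat.of C C)) →ₗ[B] K) →ₗ[C]
      (((ModuleCat.restrictScalars (algebraMap B C)).obj (ModuleCat.of C C)) →ₗ[B] P) :=
    { toFun := fun θ => f.hom ∘ₗ θ
      map_add' := fun θ θ' => LinearMap.comp_add _ _ _
      map_smul' := fun s θ => by apply LinearMap.ext; intro w; rfl }
  have hWf : Function.Injective Wf := by
    intro θ θ' hθ
    apply LinearMap.ext
    intro w
    exact hf (LinearMap.congr_fun hθ w)
  obtain ⟨n', i', p', hi'p'⟩ := exists_coext_retract_pi_conductor hinj hbir 𝔠 h𝔠 P'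
  let ψ : (((ModuleCat.restrictScalars (algebraMap B C)).obj (ModuleCat.of C C)) →ₗ[B] P) →ₗ[C]
      (Fin n' → C) :=
    (LinearMap.compLeft 𝔠.subtype (Fin n')) ∘ₗ i' ∘ₗ Wφ
  have hψker : ∀ θ, ψ θ = 0 ↔ Wφ θ = 0 := by
    intro θ
    constructor
    · intro h
      have h2 : i' (Wφ θ) = 0 := by
        ext j
        exact congrFun h j
      rw [← hi'p' (Wφ θ), h2, map_zero]
    · intro h
      change LinearMap.compLeft 𝔠.subtype (Fin n') (i' (Wφ θ)) = 0
      rw [h, map_zero, map_zero]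
  -- exactness of `0 → W(K) → W(P) → range ψ → 0`
  have hexa : Function.Exact Wf ψ.rangeRestrict := by
    rw [LinearMap.exact_iff, LinearMap.ker_rangeRestrict]
    ext θ'
    rw [LinearMap.mem_ker, hψker]
    constructor
    · intro hθ'
      have hmem : ∀ w, θ' w ∈ LinearMap.range f.hom := fun w => by
        rw [hfφ, LinearMap.mem_ker]
        exact LinearMap.congr_fun hθ' w
      refine ⟨(LinearEquiv.ofInjective f.hom hf).symm.toLinearMap ∘ₗ
        LinearMap.codRestrict (LinearMap.range f.hom) θ' hmem, ?_⟩
      apply LinearMap.ext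
      intro w
      exact LinearEquiv.ofInjective_symm_apply (h := hf) f.hom ⟨θ' w, hmem w⟩
    · rintro ⟨θ'', rfl⟩
      apply LinearMap.ext
      intro w
      have hw : f.hom (θ'' w) ∈ LinearMap.ker φ := hfφ ▸ LinearMap.mem_range_self _ _
      exact hw
  obtain ⟨wa, hSa⟩ := exists_shortExact_of_linearMap
    (Y := ModuleCat.of C (((ModuleCat.restrictScalars (algebraMap B C)).obj (ModuleCat.of C C)) →ₗ[B] K))
    (M := ModuleCat.of C (((ModuleCat.restrictScalars (algebraMap B C)).obj (ModuleCat.of C C)) →ₗ[B] P))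
    (X := ModuleCat.of C ↥(LinearMap.range ψ)) Wf ψ.rangeRestrict hWf
    (LinearMap.surjective_rangeRestrict ψ) hexa
  -- exactness of `0 → range ψ → Cⁿ' → Cⁿ' ⧸ range ψ → 0` (free middle term)
  obtain ⟨wb, hSb⟩ := exists_shortExact_of_linearMap (X := ModuleCat.of C ((Fin n' → C) ⧸ LinearMap.range ψ))
    (M := ModuleCat.of C (Fin n' → C)) (Y := ModuleCat.of C ↥(LinearMap.range ψ)) (LinearMap.range ψ).subtype
    (LinearMap.range ψ).mkQ (Submodule.injective_subtype _) (Submodule.mkQ_surjective _)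
    (LinearMap.exact_subtype_mkQ _)
  haveI : HasProjectiveDimensionLT (ShortComplex.mk (ModuleCat.ofHom (LinearMap.range ψ).subtype)
      (ModuleCat.ofHom (LinearMap.range ψ).mkQ) wb).X₂ 1 := by
    change HasProjectiveDimensionLT (ModuleCat.of C (Fin n' → C)) 1
    infer_instance
  -- `W(K)` is finitely generated; a finite free presentation
  haveI hWK : Module.Finite C (((ModuleCat.restrictScalars (algebraMap B C)).obj (ModuleCat.of C C))
      →ₗ[B] K) := Module.Finite.of_injective Wf hWf
  obtain ⟨m, q, hq⟩ := Module.Finite.exists_fin' C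
    (((ModuleCat.restrictScalars (algebraMap B C)).obj (ModuleCat.of C C)) →ₗ[B] K)
  have hSq := LinearMap.shortExact_shortComplexKer hq
  haveI : Module.Finite C (LinearMap.ker q) := Module.IsNoetherian.finite C _
  -- the kill: `y₁y₂ · Ext¹_C(W(K), N) = 0` for finitely generated `N`
  have hkill : ∀ (N : ModuleCat.{u} C), Module.Finite C N →
      ∀ e : Ext.{u} (ModuleCat.of C (((ModuleCat.restrictScalars (algebraMap B C)).obj (ModuleCat.of C C))
        →ₗ[B] K)) N 1, (y₁ * y₂) • e = 0 := by
    intro N hN e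
    haveI := hN
    have hb2 : ∀ e' : Ext.{u} (ModuleCat.of C ↥(LinearMap.range ψ)) N 2, y₂ • e' = 0 := fun e' =>
      smul_ext_eq_zero_of_shortExact_of_hasProjectiveDimensionLT hSb (n := 1) (i := 2) (by omega)
        (fun e'' => smul_eq_zero_of_mem_cohomologyAnnihilatorOfDegree hy₂ (le_refl 3) e'') e'
    exact mul_smul_ext_eq_zero_of_shortExact hSa (i := 1)
      (fun e'' => smul_ext_coext_eq_zero_of_isSyzygy_two_conductor hinj hbir 𝔠 h𝔠 h𝔠syz hy₁ P N
        le_rfl e'') hb2 e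
  have hcls : (y₁ * y₂) • hSq.extClass = 0 := hkill _ inferInstance _
  obtain ⟨χ, hχ⟩ := exists_comp_eq_smul_id_X₃_of_smul_extClass_eq_zero hSq hcls
  have hχq : ∀ θ, q (χ.hom θ) = (y₁ * y₂) • θ := fun θ => by
    have := congrArg (fun ξ => ξ.hom θ) hχ
    simpa using this
  exact stablyAnnihilates_of_coextension_factor hinj hc hc' K hb χ.hom q hχq

/-! ## The route's vocabulary (lead-1's item (ii)): subalgebras `B ≤ C` of a field -/

section RouteVocabulary

variable {k K : Type u} [Field k] [Field K] [Algebra k K]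

/-- **Birationality of `B ≤ C ⊆ Frac B`**: for subalgebras `B ≤ C` of a field `K` with `Frac B = K`, every
`γ ∈ C` has `b·γ ∈ B` for some nonzero `b ∈ B` — in the currency of the ring-map files (`Subalgebra.inclusion`).
[folklore] -/
theorem _root_.Subalgebra.exists_ne_zero_inclusion_mul (B C : Subalgebra k K) (hBC : B ≤ C)
    [IsFractionRing ↥B K] (γ : ↥C) :
    ∃ b : ↥B, b ≠ 0 ∧ ∃ b' : ↥B, Subalgebra.inclusion hBC b' = Subalgebra.inclusion hBC b * γ := by
  obtain ⟨⟨b', b⟩, h⟩ := IsLocalization.surj (nonZeroDivisors ↥B) (γ : K)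
  refine ⟨b.1, nonZeroDivisors.ne_zero b.2, b', Subtype.ext ?_⟩
  change (b' : K) = (b.1 : K) * (γ : K)
  have h' : (γ : K) * (b.1 : K) = (b' : K) := h
  rw [← h', mul_comm]

/-- **The conductor floor for a projective conductor, route vocabulary.**  `B ≤ C` subalgebras of a field `K`
over `k` with `Frac B = K`, `B` and `C` noetherian, `𝔠 ⊆ C` the conductor ideal (`γ ∈ 𝔠 ↔ γ·C ⊆ B`) assumed
PROJECTIVE over `C`; `c, c' ∈ B` with `c·C ⊆ B`, `c'·C ⊆ B`, `y ∈ ca³(C)` and `b ∈ B` the element `c'·y`: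
then `c·b ∈ ca³(B)` (the ring-map theorem
`…ConductorFloorGeneral.mul_mem_cohomologyAnnihilatorOfDegree_three_of_conductor_of_projective` along the inclusion
`B → C`). [cite: IyengarTakahashi2014, Remark 2.13] -/
theorem _root_.Subalgebra.mul_conductor_mem_cohomologyAnnihilatorOfDegree_three_of_projective
    (B C : Subalgebra k K) (hBC : B ≤ C) [IsFractionRing ↥B K] [IsNoetherianRing ↥B] [IsNoetherianRing ↥C]
    (𝔠 : Ideal ↥C) (h𝔠 : ∀ γ : ↥C, γ ∈ 𝔠 ↔ ∀ δ : ↥C, (γ : K) * δ ∈ B) [Module.Projective ↥C ↥𝔠]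
    {c c' b : ↥B} (hc : ∀ γ ∈ C, (c : K) * γ ∈ B) (hc' : ∀ γ ∈ C, (c' : K) * γ ∈ B)
    {y : ↥C} (hy : y ∈ cohomologyAnnihilatorOfDegree ↥C 3) (hb : (b : K) = (c' : K) * (y : K)) :
    c * b ∈ cohomologyAnnihilatorOfDegree ↥B 3 := by
  letI : Algebra ↥B ↥C := (Subalgebra.inclusion hBC).toRingHom.toAlgebra
  have hinj : Function.Injective (algebraMap ↥B ↥C) := Subalgebra.inclusion_injective hBC
  have hbir : ∀ γ : ↥C, ∃ b : ↥B, b ≠ 0 ∧ ∃ b' : ↥B, algebraMap ↥B ↥C b' = algebraMap ↥B ↥C b * γ :=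
    Subalgebra.exists_ne_zero_inclusion_mul B C hBC
  have h𝔠' : ∀ γ : ↥C, γ ∈ 𝔠 ↔ ∀ δ : ↥C, ∃ x : ↥B, algebraMap ↥B ↥C x = γ * δ := by
    intro γ
    rw [h𝔠]
    refine forall_congr' fun δ => ⟨fun h => ⟨⟨(γ : K) * δ, h⟩, Subtype.ext rfl⟩, fun ⟨x, hx⟩ => ?_⟩
    have : ((γ * δ : ↥C) : K) = (x : K) := by rw [← hx]; rfl
    rw [Subalgebra.coe_mul] at this
    rw [this]
    exact x.2
  have hcond : ∀ {c : ↥B}, (∀ γ ∈ C, (c : K) * γ ∈ B) →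
      ∀ γ : ↥C, ∃ x : ↥B, algebraMap ↥B ↥C x = algebraMap ↥B ↥C c * γ :=
    fun {c} hc γ => ⟨⟨(c : K) * γ, hc γ γ.2⟩, Subtype.ext rfl⟩
  have hb' : algebraMap ↥B ↥C b = algebraMap ↥B ↥C c' * y := Subtype.ext hb
  exact mul_mem_cohomologyAnnihilatorOfDegree_three_of_conductor_of_projective hinj hbir 𝔠 h𝔠' (hcond hc)
    (hcond hc') hy hb'

/-- **The conductor floor for a conductor that is a second syzygy, route vocabulary.**  As above with `𝔠`
only a second `C`-syzygy (`𝔠 ≅ Ω²_C M₀`, e.g. reflexive) and two elements `y₁, y₂ ∈ ca³(C)`: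
`c·b ∈ ca³(B)` for `b = c'·y₁y₂`. [cite: IyengarTakahashi2014, Remark 2.13] -/
theorem _root_.Subalgebra.mul_conductor_mem_cohomologyAnnihilatorOfDegree_three_of_isSyzygy_two
    (B C : Subalgebra k K) (hBC : B ≤ C) [IsFractionRing ↥B K] [IsNoetherianRing ↥B] [IsNoetherianRing ↥C]
    (𝔠 : Ideal ↥C) (h𝔠 : ∀ γ : ↥C, γ ∈ 𝔠 ↔ ∀ δ : ↥C, (γ : K) * δ ∈ B)
    {M₀ : ModuleCat.{u} ↥C} (h𝔠syz : IsSyzygy 2 M₀ (ModuleCat.of ↥C ↥𝔠))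
    {c c' b : ↥B} (hc : ∀ γ ∈ C, (c : K) * γ ∈ B) (hc' : ∀ γ ∈ C, (c' : K) * γ ∈ B)
    {y₁ y₂ : ↥C} (hy₁ : y₁ ∈ cohomologyAnnihilatorOfDegree ↥C 3)
    (hy₂ : y₂ ∈ cohomologyAnnihilatorOfDegree ↥C 3) (hb : (b : K) = (c' : K) * ((y₁ : K) * (y₂ : K))) :
    c * b ∈ cohomologyAnnihilatorOfDegree ↥B 3 := by
  letI : Algebra ↥B ↥C := (Subalgebra.inclusion hBC).toRingHom.toAlgebra
  have hinj : Function.Injective (algebraMap ↥B ↥C) := Subalgebra.inclusion_injective hBC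
  have hbir : ∀ γ : ↥C, ∃ b : ↥B, b ≠ 0 ∧ ∃ b' : ↥B, algebraMap ↥B ↥C b' = algebraMap ↥B ↥C b * γ :=
    Subalgebra.exists_ne_zero_inclusion_mul B C hBC
  have h𝔠' : ∀ γ : ↥C, γ ∈ 𝔠 ↔ ∀ δ : ↥C, ∃ x : ↥B, algebraMap ↥B ↥C x = γ * δ := by
    intro γ
    rw [h𝔠]
    refine forall_congr' fun δ => ⟨fun h => ⟨⟨(γ : K) * δ, h⟩, Subtype.ext rfl⟩, fun ⟨x, hx⟩ => ?_⟩
    have : ((γ * δ : ↥C) : K) = (x : K) := by rw [← hx]; rfl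
    rw [Subalgebra.coe_mul] at this
    rw [this]
    exact x.2
  have hcond : ∀ {c : ↥B}, (∀ γ ∈ C, (c : K) * γ ∈ B) →
      ∀ γ : ↥C, ∃ x : ↥B, algebraMap ↥B ↥C x = algebraMap ↥B ↥C c * γ :=
    fun {c} hc γ => ⟨⟨(c : K) * γ, hc γ γ.2⟩, Subtype.ext rfl⟩
  have hb' : algebraMap ↥B ↥C b = algebraMap ↥B ↥C c' * (y₁ * y₂) := Subtype.ext hb
  exact mul_mem_cohomologyAnnihilatorOfDegree_three_of_conductor_of_isSyzygy_two hinj hbir 𝔠 h𝔠' h𝔠syz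
    (hcond hc) (hcond hc') hy₁ hy₂ hb'

end RouteVocabulary


end Summit.ResolutionOfSingularities.ResolutionOfSingularities.Theorems.HomologicalConductor.PersistenceConductorFloorSyzygy

end
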